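/-
Copyright: rh-split cell (screw, width prover seat l1-w3) gen 0, 2026-08-27.  Splitting search over
kernel-typed RH-equivalences.  A splitting `A ∧ B ⟹ RH` is CONDITIONAL bookkeeping unless `A` and `B` are
both proved; nothing here bears on the truth of RH.
-/
import Summits.RiemannHypothesis.RiemannHypothesis.Theorems.Splittings.ScrewDustPointComponent
import Summits.RiemannHypothesis.RiemannHypothesis.Theorems.Splittings.ScrewDustTotallyDisconnected
import HarnessLib

/-!
# ROW X-11 «DUST WALL» — `CEIL(h) ∧ TD(h) ⟺ RH` for every step `h > 0`, unconditional bookkeeping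

`TD(h)` («dust wall»): the closure `T_h` of the aliased pole field `aliasedPoleSet h = {e^{∓(ρ-1/2)h}} ∩ 𝔻`
(folded zeros off the critical line) meets the open unit disc in a TOTALLY DISCONNECTED set.  With the
kernel theorem `PointComponentInvisible` (item stmt-RiemannHypothesis-21690, RH-free and ζ-free, proved:
`ScrewDust.PointComponentInvisible_proof`), the non-separation theorem of item 21692 and the plane
topology of `ScrewDustTotallyDisconnected`, the row of the route `ScrewDustWall` is a tree theorem:

1. ζ-free: `poleSet_eq_empty_of_isTotallyDisconnected` — a sign-definite `ℓ¹` Borel family whose sum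
   continues holomorphically to `𝔻` and whose wall is totally disconnected has NO inside pole; and the
   contrapositive `exists_continuum_of_poleSet_nonempty` — a visible inside pole forces a non-degenerate
   continuum (a preconnected set with two points) inside the wall.
2. ζ-side, every `h > 0`: `aliasedPoleSet_eq_empty_of_latticeCeiling_of_isTotallyDisconnected`,
   `rh_of_latticeCeiling_of_isTotallyDisconnected`, the row `latticeCeiling_and_isTotallyDisconnected_iff_rh`
   and the RH-free dichotomy `latticeCeiling_dichotomy_continuum`: under `CEIL(h)`, EITHER RH holds OR the
   folded far zeros accumulate along a non-degenerate continuum inside `𝔻` — the searchable object of X-11.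
3. `h = 1`, the route decls by name: `dustWall_of_thinWall` (X-10's conjunct implies X-11's),
   `dustWall_of_countableClosure`, `dustWall_of_rh`, `dustWall_of_foz`, `ceil_of_rh`,
   `rh_of_latticeCeiling_of_dustWall`, and **`latticeCeiling_and_dustWall_iff_rh`** (the row of record's
   shape, cf. X-10 `latticeCeiling_and_thinWall_iff_rh`, X-14 `latticeCeiling_and_encirclable_iff_rh`),
   with `x11_of_x10` / `x11_of_x9` (survivor chain X-9 ⊆ X-10 ⊆ X-11 hypotheses-wise).

X-11 is a CONDITIONAL splitting: its conjunct `DustWall` = TD(1) (item 21691) and its residual `Ceil` =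
CEIL(1) (item 21693) are OPEN conjectures, RH-implied, and are not claimed here.  RH is not proved by this;
nothing here bears on the truth of RH.  No `sorry`, no new axioms, no definitions, no instances, no notation.
-/

set_option linter.dupNamespace false

namespace Summit.RiemannHypothesis.RiemannHypothesis.Theorems.Splittings.ScrewDust

open Set Metric
open Literature.NumberTheory.LFunctions
open Summit.RiemannHypothesis.RiemannHypothesis.Theorems.Splittings.ScrewBorel
open Summit.RiemannHypothesis.RiemannHypothesis.Theorems.Splittings.ScrewLatticeContinuation
open Summit.RiemannHypothesis.RiemannHypothesis.Theorems.Splittings.ScrewLatticeThinWall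

/-! ## 1. The ζ-free row: a totally disconnected wall carries no inside pole -/

/-- **ζ-free X-11 kernel row.**  For a sign-definite `ℓ¹` Borel family (`∑‖c_i‖ < ∞`, `Re c_i < 0`,
`u_i ≠ 0`) and `F` holomorphic on `𝔻` agreeing with the Borel series `∑ term (c_i) (u_i)` on a pole-free
ball `ball 0 r₀`: if the wall `closure (poleSet u) ∩ 𝔻` is totally disconnected, then there is NO inside
pole at all.  (An inside pole `p` would be a point-component of the wall
(`connectedComponentIn_subset_singleton`) and — the wall containing no disc
(`subset_closure_diff_of_isTotallyDisconnected`) and not separating the disc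
(`isPreconnected_ball_diff_of_isTotallyDisconnected`) — adherent to the origin's component of the regular
set, which `PointComponentInvisible_proof` forbids.) -/
theorem poleSet_eq_empty_of_isTotallyDisconnected {ι : Type} {c u : ι → ℂ}
    (hc : Summable fun i ↦ ‖c i‖) (hre : ∀ i, (c i).re < 0) (hu : ∀ i, u i ≠ 0) {F : ℂ → ℂ}
    (hF : DifferentiableOn ℂ F (ball 0 1)) {r₀ : ℝ} (hr₀ : 0 < r₀) (hS : ∀ p ∈ poleSet u, r₀ ≤ ‖p‖)
    (hFB : EqOn F (fun z ↦ ∑' i, term (c i) (u i) z) (ball 0 r₀))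
    (htd : IsTotallyDisconnected (closure (poleSet u) ∩ ball (0 : ℂ) 1)) : poleSet u = ∅ := by
  rcases Set.eq_empty_or_nonempty (poleSet u) with h | ⟨p, hp⟩
  · exact h
  exfalso
  set T : Set ℂ := closure (poleSet u) with hT
  have hcomp : connectedComponentIn (T ∩ ball (0 : ℂ) 1) p ⊆ {p} :=
    connectedComponentIn_subset_singleton htd p
  have hconn : IsPreconnected (ball (0 : ℂ) 1 \ T) :=
    isPreconnected_ball_diff_of_isTotallyDisconnected isClosed_closure htd
  have h0 : (0 : ℂ) ∈ ball (0 : ℂ) 1 \ T := by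
    refine ⟨mem_ball_self one_pos, fun h0 ↦ ?_⟩
    have hclos : T ⊆ {q : ℂ | r₀ ≤ ‖q‖} :=
      closure_minimal (fun q hq ↦ hS q hq) (isClosed_le continuous_const continuous_norm)
    have := hclos h0
    simp only [mem_setOf_eq, norm_zero] at this
    exact absurd this (not_le.2 hr₀)
  have hΩ : ball (0 : ℂ) 1 \ T ⊆ connectedComponentIn (ball (0 : ℂ) 1 \ T) 0 :=
    hconn.subset_connectedComponentIn h0 Subset.rfl
  have hadh : p ∈ closure (connectedComponentIn (ball (0 : ℂ) 1 \ T) 0) :=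
    closure_mono hΩ
      (subset_closure_diff_of_isTotallyDisconnected isOpen_ball htd (mem_ball_zero_iff.2 hp.1))
  exact PointComponentInvisible_proof c u hc hre hu F hF r₀ hr₀ hS hFB p hp hcomp hadh

/-- **A visible inside pole forces a continuum in the wall** (ζ-free, contrapositive form): under the
same hypotheses, if the Borel family has an inside pole then the wall `closure (poleSet u) ∩ 𝔻` contains
a preconnected subset with two distinct points. -/
theorem exists_continuum_of_poleSet_nonempty {ι : Type} {c u : ι → ℂ}
    (hc : Summable fun i ↦ ‖c i‖) (hre : ∀ i, (c i).re < 0) (hu : ∀ i, u i ≠ 0) {F : ℂ → ℂ}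
    (hF : DifferentiableOn ℂ F (ball 0 1)) {r₀ : ℝ} (hr₀ : 0 < r₀) (hS : ∀ p ∈ poleSet u, r₀ ≤ ‖p‖)
    (hFB : EqOn F (fun z ↦ ∑' i, term (c i) (u i) z) (ball 0 r₀)) (hne : (poleSet u).Nonempty) :
    ∃ t ⊆ closure (poleSet u) ∩ ball (0 : ℂ) 1, IsPreconnected t ∧ t.Nontrivial := by
  by_contra hno
  have htd : IsTotallyDisconnected (closure (poleSet u) ∩ ball (0 : ℂ) 1) := by
    intro t hts htc
    by_contra hnt
    exact hno ⟨t, hts, htc, Set.not_subsingleton_iff.1 hnt⟩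
  rw [poleSet_eq_empty_of_isTotallyDisconnected hc hre hu hF hr₀ hS hFB htd] at hne
  exact Set.not_nonempty_empty hne

/-! ## 2. ζ-side, every step `h > 0` -/

/-- **`CEIL(h) ∧ TD(h) ⟹` the aliased pole field is empty** (`h > 0`): the ζ-free row applied to
Suzuki's data (`coeff`, `mult h`, `latticeGF h`, `r₀ = e^{-h/2}`; the tree dictionary
`summable_norm_coeff`, `re_coeff_neg`, `mult_ne_zero`, `differentiableOn_latticeGF`,
`exp_neg_half_le_norm_of_mem`, `latticeGF_eq_borel`). -/
theorem aliasedPoleSet_eq_empty_of_latticeCeiling_of_isTotallyDisconnected {h : ℝ} (hh : 0 < h)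
    (hceil : LatticeCeiling h)
    (htd : IsTotallyDisconnected (closure (aliasedPoleSet h) ∩ ball (0 : ℂ) 1)) :
    aliasedPoleSet h = ∅ :=
  poleSet_eq_empty_of_isTotallyDisconnected summable_norm_coeff re_coeff_neg (mult_ne_zero h)
    (differentiableOn_latticeGF hceil) (Real.exp_pos (-(h / 2)))
    (fun _ hp ↦ exp_neg_half_le_norm_of_mem hh.le hp)
    (fun _ hz ↦ latticeGF_eq_borel hh (mem_ball_zero_iff.1 hz)) htd

/-- **`CEIL(h) ∧ TD(h) ⟹ RH`** (`h > 0`). -/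
theorem rh_of_latticeCeiling_of_isTotallyDisconnected {h : ℝ} (hh : 0 < h) (hceil : LatticeCeiling h)
    (htd : IsTotallyDisconnected (closure (aliasedPoleSet h) ∩ ball (0 : ℂ) 1)) :
    RiemannHypothesis := by
  by_contra hnot
  have hne := aliasedPoleSet_nonempty_of_not_rh hh hnot
  rw [aliasedPoleSet_eq_empty_of_latticeCeiling_of_isTotallyDisconnected hh hceil htd] at hne
  exact Set.not_nonempty_empty hne

/-- **ROW X-11 at every step** (`h > 0`): `CEIL(h) ∧ TD(h) ↔ RiemannHypothesis`.  (It contains row X-10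
`latticeCeiling_and_thinWall_iff_rh` through `isTotallyDisconnected_wall_of_thinWall`, and row X-9
through `isTotallyDisconnected_wall_of_countableClosure`.) -/
theorem latticeCeiling_and_isTotallyDisconnected_iff_rh {h : ℝ} (hh : 0 < h) :
    (LatticeCeiling h ∧ IsTotallyDisconnected (closure (aliasedPoleSet h) ∩ ball (0 : ℂ) 1)) ↔
      RiemannHypothesis :=
  ⟨fun hab ↦ rh_of_latticeCeiling_of_isTotallyDisconnected hh hab.1 hab.2,
    fun hRH ↦ ⟨latticeCeiling_of_rh hRH h, isTotallyDisconnected_wall_of_rh hRH h⟩⟩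

/-- **THE DICHOTOMY (RH-free content)**, `h > 0`: if the lattice samples `Ψ(k h)` grow sub-exponentially,
then EITHER the Riemann hypothesis holds OR the closure of the aliased pole field contains, inside the unit
disc, a NON-DEGENERATE CONTINUUM piece — a preconnected subset with two distinct points (folded far zeros
accumulating along a connected set).  Strictly sharper than the X-10 dichotomy
`latticeCeiling_dichotomy_length` (positive length does not give a continuum; a continuum has positive
length). -/
theorem latticeCeiling_dichotomy_continuum {h : ℝ} (hh : 0 < h) (hceil : LatticeCeiling h) :
    RiemannHypothesis ∨
      ∃ t ⊆ closure (aliasedPoleSet h) ∩ ball (0 : ℂ) 1, IsPreconnected t ∧ t.Nontrivial := by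
  by_cases htd : IsTotallyDisconnected (closure (aliasedPoleSet h) ∩ ball (0 : ℂ) 1)
  · exact Or.inl (rh_of_latticeCeiling_of_isTotallyDisconnected hh hceil htd)
  · right
    simp only [IsTotallyDisconnected, not_forall] at htd
    obtain ⟨t, hts, htc, hnt⟩ := htd
    exact ⟨t, hts, htc, Set.not_subsingleton_iff.1 hnt⟩

/-- **Under `¬RH` and `CEIL(h)` the folded far zeros accumulate along a continuum** (`h > 0`; recorded
form of the dichotomy for zero-search instruments). -/
theorem exists_continuum_of_latticeCeiling_of_not_rh {h : ℝ} (hh : 0 < h) (hceil : LatticeCeiling h)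
    (hnot : ¬ RiemannHypothesis) :
    ∃ t ⊆ closure (aliasedPoleSet h) ∩ ball (0 : ℂ) 1, IsPreconnected t ∧ t.Nontrivial :=
  (latticeCeiling_dichotomy_continuum hh hceil).resolve_left hnot

/-! ## 3. Step `h = 1`: the route decls by name, and the row of record's shape -/

/-- **`ThinWall 1 ⟹ DustWall`**: the conjunct of X-10 implies the conjunct of X-11 (X-11 ⊇ X-10). -/
theorem dustWall_of_thinWall (htw : ThinWall 1) : Theses.ScrewDustWall.DustWall :=
  isTotallyDisconnected_wall_of_thinWall htw

/-- **`CountableClosure 1 ⟹ DustWall`** (X-11 ⊇ X-9). -/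
theorem dustWall_of_countableClosure (hcc : CountableClosure 1) : Theses.ScrewDustWall.DustWall :=
  isTotallyDisconnected_wall_of_countableClosure hcc

/-- **RH ⟹ DustWall** (the conjunct is RH-implied, vacuously). -/
theorem dustWall_of_rh (hRH : RiemannHypothesis) : Theses.ScrewDustWall.DustWall :=
  isTotallyDisconnected_wall_of_rh hRH 1

/-- **FOZ ⟹ DustWall**: finitely many off-line zeros already give the dust wall, so `DustWall ⇏ RH` by
itself (T1 separating scenario) and the residual `Ceil` is load-bearing. -/
theorem dustWall_of_foz (hfoz : Theses.RuelleBand.CofiniteCriticalLine) :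
    Theses.ScrewDustWall.DustWall :=
  isTotallyDisconnected_wall_of_foz hfoz 1

/-- **RH ⟹ Ceil** (the residual `CEIL(1)` is RH-implied: `latticeCeiling_of_rh`). -/
theorem ceil_of_rh (hRH : RiemannHypothesis) : Theses.ScrewDustWall.Ceil :=
  latticeCeiling_of_rh hRH 1

/-- **`CEIL(1) ∧ DustWall ⟹ RH`** (unconditional over the tree's closers of items 21690 and 21692). -/
theorem rh_of_latticeCeiling_of_dustWall (hceil : LatticeCeiling 1)
    (htd : Theses.ScrewDustWall.DustWall) : RiemannHypothesis :=
  rh_of_latticeCeiling_of_isTotallyDisconnected one_pos hceil htd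

/-- **ROW X-11 (the splitting, unconditional bookkeeping)**: `CEIL(1) ∧ DustWall ↔ RiemannHypothesis`,
i.e. `LatticeCeiling 1 ∧ TD(1) ⟺ RH` — the shape of the rows of record X-10
`ScrewLatticeThinWall.latticeCeiling_and_thinWall_iff_rh` and X-14
`ScrewLatticeGauss.latticeCeiling_and_encirclable_iff_rh`.  Both conjuncts are OPEN and RH-implied. -/
theorem latticeCeiling_and_dustWall_iff_rh :
    (LatticeCeiling 1 ∧ Theses.ScrewDustWall.DustWall) ↔ RiemannHypothesis :=
  ⟨fun hab ↦ rh_of_latticeCeiling_of_dustWall hab.1 hab.2,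
    fun hRH ↦ ⟨latticeCeiling_of_rh hRH 1, dustWall_of_rh hRH⟩⟩

/-- The same row with the route's residual decl `Ceil` (`= LatticeCeiling 1` by definition). -/
theorem ceil_and_dustWall_iff_rh :
    (Theses.ScrewDustWall.Ceil ∧ Theses.ScrewDustWall.DustWall) ↔ RiemannHypothesis :=
  latticeCeiling_and_dustWall_iff_rh

/-- **X-10 ⟹ X-11 hypotheses-wise at `h = 1`** (survivor chain): `CEIL(1) ∧ TW(1)` implies
`CEIL(1) ∧ DustWall`. -/
theorem x11_of_x10 (hab : LatticeCeiling 1 ∧ ThinWall 1) :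
    LatticeCeiling 1 ∧ Theses.ScrewDustWall.DustWall :=
  ⟨hab.1, dustWall_of_thinWall hab.2⟩

/-- **X-9 ⟹ X-11 hypotheses-wise at `h = 1`**: `CEIL(1) ∧ CC(1)` implies `CEIL(1) ∧ DustWall`. -/
theorem x11_of_x9 (hab : LatticeCeiling 1 ∧ CountableClosure 1) :
    LatticeCeiling 1 ∧ Theses.ScrewDustWall.DustWall :=
  ⟨hab.1, dustWall_of_countableClosure hab.2⟩

end Summit.RiemannHypothesis.RiemannHypothesis.Theorems.Splittings.ScrewDust
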